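import Mathlib
import Literature.NumberTheory.EllipticCurves.ModularFormLevelRaisingProofs

/-! # Route CapacityClassicality — finite `V`-towers over a classical form are classical
(stub for crux stmt-Langlands-8927, line Sketch)

Let `h` be a modular form of weight `k` on `Γ₁(M)` (`M ≥ 1`), `L ≥ 1` and `μ : ℕ → ℂ`.  The finite
`V`-tower `G(τ) = Σ_{e ∣ L} μ_e h(eτ)` is a modular form of weight `k` on `Γ₁(M L)` with
`a_n(G) = Σ_{e ∣ L, e ∣ n} μ_e a_{n/e}(h)`.

Proof.  For `e ∣ L`, `h(eτ) = e^{1-k} (h ∣_k diag(e,1))(τ)`, and the degeneracy correspondence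
`[Γ₁(M) diag(e,1) Γ₁(ML)]` of the Literature Hecke-correspondence library is the single slash
`h ↦ h ∣_k diag(e,1)` (the double coset is one right coset since `M e ∣ M L`, Diamond–Shurman
§5.6), a modular form on `Γ₁(ML)` with `a_n = e^{k-1} [e ∣ n] a_{n/e}(h)` (Diamond–Shurman §5.7,
`ι_e`).  Take `G := Σ_{e ∣ L} (μ_e e^{1-k}) • [Γ₁(M) diag(e,1) Γ₁(ML)] h` and read off the
coefficients (`q`-expansion is additive).
-/

set_option linter.dupNamespace false -- `Summit.Langlands.Langlands` is the mandated namespace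

noncomputable section

open UpperHalfPlane ModularForm Complex CongruenceSubgroup
open Literature.NumberTheory.EllipticCurves.ModularForms
open scoped MatrixGroups

namespace Summit.Langlands.Langlands.Theorems.CapacityClassicality

/-! ### The degeneracy operator `[Γ₁(M) diag(e,1) Γ₁(N)]`, `M e ∣ N` -/

/-- `(1 : ℝ)` is a strict period of `Γ₁(L)`. [folklore] -/
private theorem one_mem_strictPeriods_gamma1 (L : ℕ) :
    (1 : ℝ) ∈ (Gamma1 L : Subgroup (GL (Fin 2) ℝ)).strictPeriods := by simp

/-- The degeneracy correspondence `[Γ₁(M) diag(e,1) Γ₁(N)]`, `M e ∣ N`, is the single slash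
`[diag(e,1)]_k` (the double coset `Γ₁(M) diag(e,1) Γ₁(N)` is the single right coset
`Γ₁(M) diag(e,1)`). [cite: DiamondShurman2005, §5.6 p. 209] -/
private theorem coe_heckeCorrespondence_diagGL {M N : ℕ} [NeZero M] [NeZero N] {k : ℤ}
    (E : ModularForm (Gamma1 M) k) {e : ℕ} (he : 0 < e) (hMe : M * e ∣ N) :
    (⇑(heckeCorrespondence (Gamma1 M) (Gamma1 N) k
        (diagGL ((e : ℕ) : ℚ) 1 (Nat.cast_pos.mpr he) one_pos : GL (Fin 2) ℚ) E) : ℍ → ℂ) =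
      ⇑E ∣[k] glCast ((diagGL ((e : ℕ) : ℚ) 1 (Nat.cast_pos.mpr he) one_pos : GL(2, ℚ)⁺) :
        GL (Fin 2) ℚ) := by
  rw [coe_heckeCorrespondence_eq_sum _ _ k _
    (isDoubleCosetDecomp_diagGL_gamma1 (M := M) (N := N) he hMe)]
  simp

/-- **`q`-expansion of the degeneracy operator** `[Γ₁(M) diag(e,1) Γ₁(N)] E = E ∣_k diag(e,1)
= e^{k-1} E(e·)` for `M e ∣ N`: `a_n = e^{k-1} [e ∣ n] a_{n/e}(E)` (Diamond–Shurman §5.7, p. 211,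
the map `ι_e`). [cite: DiamondShurman2005, §5.7 p. 211] -/
theorem qExpansion_coeff_degeneracy {M N : ℕ} [NeZero M] [NeZero N] {k : ℤ}
    (E : ModularForm (Gamma1 M) k) {e : ℕ} (he : 0 < e) (hMe : M * e ∣ N) (n : ℕ) :
    (qExpansion 1 ⇑(heckeCorrespondence (Gamma1 M) (Gamma1 N) k
        (diagGL ((e : ℕ) : ℚ) 1 (Nat.cast_pos.mpr he) one_pos : GL (Fin 2) ℚ) E)).coeff n =
      (e : ℂ) ^ (k - 1) * (if e ∣ n then (qExpansion 1 ⇑E).coeff (n / e) else 0) := by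
  have he0 : (e : ℂ) ≠ 0 := Nat.cast_ne_zero.mpr he.ne'
  set F := heckeCorrespondence (Gamma1 M) (Gamma1 N) k
    (diagGL ((e : ℕ) : ℚ) 1 (Nat.cast_pos.mpr he) one_pos : GL (Fin 2) ℚ) E with hF_def
  -- `F τ = e^{k-1} E(eτ)`
  have hFτ : ∀ τ : ℍ, F τ = (e : ℂ) ^ (k - 1) *
      E ⟨(e : ℂ) * τ, by simpa using mul_pos (Nat.cast_pos.mpr he) τ.2⟩ := fun τ ↦ by
    have h1 := smul_slash_diagGL_apply k e he ⇑E τ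
    rw [← coe_heckeCorrespondence_diagGL E he hMe, Pi.smul_apply, smul_eq_mul] at h1
    have h2 : ((⟨(e : ℝ), Nat.cast_pos.mpr he⟩ : {x : ℝ // 0 < x}) • τ : ℍ) =
        ⟨(e : ℂ) * τ, by simpa using mul_pos (Nat.cast_pos.mpr he) τ.2⟩ := by
      apply UpperHalfPlane.ext
      simp [UpperHalfPlane.coe_pos_real_smul]
    rw [h2] at h1
    rw [← h1, ← mul_assoc, ← zpow_add₀ he0, show k - 1 + (1 - k) = 0 by ring, zpow_zero,
      one_mul]
  symm
  refine ModularFormClass.qExpansion_coeff_unique one_pos (one_mem_strictPeriods_gamma1 N)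
    (f := F) (c := fun m ↦ (e : ℂ) ^ (k - 1) *
      (if e ∣ m then (qExpansion 1 ⇑E).coeff (m / e) else 0)) (fun τ ↦ ?_) n
  set τ' : ℍ := ⟨(e : ℂ) * τ, by simpa using mul_pos (Nat.cast_pos.mpr he) τ.2⟩ with hτ'
  have hg := hasSum_qExpansion_of_mem_strictPeriods one_pos (one_mem_strictPeriods_gamma1 M) E τ'
  have hq : Function.Periodic.qParam 1 (τ' : ℂ) = Function.Periodic.qParam 1 τ ^ e :=
    qParam_one_natMul e τ
  rw [hq] at hg
  rw [hFτ τ]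
  have hg' := hg.mul_left ((e : ℂ) ^ (k - 1))
  refine ((mul_right_injective₀ he.ne').hasSum_iff ?_).mp ?_
  · intro m hm
    have : ¬ e ∣ m := by
      rintro ⟨j, rfl⟩
      exact hm ⟨j, rfl⟩
    simp [this]
  · have hfun : ((fun m ↦ ((e : ℂ) ^ (k - 1) *
        (if e ∣ m then (qExpansion 1 ⇑E).coeff (m / e) else 0)) •
          Function.Periodic.qParam 1 τ ^ m) ∘ fun x ↦ e * x) =
        fun i ↦ (e : ℂ) ^ (k - 1) *
          ((qExpansion 1 ⇑E).coeff i • (Function.Periodic.qParam 1 τ ^ e) ^ i) := by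
      funext m
      simp only [Function.comp_apply, smul_eq_mul]
      rw [if_pos (dvd_mul_right e m), Nat.mul_div_cancel_left m he, pow_mul, mul_assoc]
    rw [hfun]
    exact hg'

/-! ### The theorem -/

/-- **Finite `V`-towers over a classical form are classical.** For a modular form `h` of weight
`k` on `Γ₁(M)` (`M ≥ 1`), `L ≥ 1` and `μ : ℕ → ℂ`, there is a modular form `G` of weight `k` on
`Γ₁(M L)` — namely `G = Σ_{e ∣ L} μ_e h(e·) = Σ_{e ∣ L} (μ_e e^{1-k}) • [Γ₁(M) diag(e,1) Γ₁(ML)] h`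
— with `a_n(G) = Σ_{e ∣ L, e ∣ n} μ_e a_{n/e}(h)`. [cite: DiamondShurman2005, §5.7 p. 211] -/
theorem finiteTowerClassical (M : ℕ) [NeZero M] (k : ℤ) (h : ModularForm (Gamma1 M) k) (L : ℕ)
    (hL : 0 < L) (μ : ℕ → ℂ) :
    ∃ G : ModularForm (Gamma1 (M * L)) k, ∀ n : ℕ,
      (qExpansion 1 ⇑G).coeff n =
        ∑ e ∈ L.divisors, if e ∣ n then μ e * (qExpansion 1 ⇑h).coeff (n / e) else 0 := by
  haveI : NeZero (M * L) := ⟨Nat.mul_ne_zero (NeZero.ne M) hL.ne'⟩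
  have hΓ := one_mem_strictPeriods_gamma1 (M * L)
  -- the summands `μ_e h(e·)` as modular forms on `Γ₁(ML)` (zero unless `0 < e ∣ L`)
  set S : ℕ → ModularForm (Gamma1 (M * L)) k := fun e ↦
    if he : 0 < e ∧ e ∣ L then
      (μ e * (e : ℂ) ^ (1 - k)) • heckeCorrespondence (Gamma1 M) (Gamma1 (M * L)) k
        (diagGL ((e : ℕ) : ℚ) 1 (Nat.cast_pos.mpr he.1) one_pos : GL (Fin 2) ℚ) h
    else 0 with hS
  have hqS : ∀ e ∈ L.divisors, ∀ n : ℕ, (qExpansion 1 ⇑(S e)).coeff n =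
      if e ∣ n then μ e * (qExpansion 1 ⇑h).coeff (n / e) else 0 := by
    intro e he n
    have he' : 0 < e ∧ e ∣ L := ⟨Nat.pos_of_mem_divisors he, Nat.dvd_of_mem_divisors he⟩
    have he0 : (e : ℂ) ≠ 0 := Nat.cast_ne_zero.mpr he'.1.ne'
    simp only [hS, dif_pos he']
    rw [IsGLPos.coe_smul, ModularForm.qExpansion_smul one_pos hΓ, map_smul, smul_eq_mul,
      qExpansion_coeff_degeneracy h he'.1 (Nat.mul_dvd_mul_left M he'.2) n]
    split_ifs with hen
    · rw [← mul_assoc, mul_assoc (μ e), ← zpow_add₀ he0, show 1 - k + (k - 1) = 0 by ring,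
        zpow_zero, mul_one]
    · rw [mul_zero, mul_zero]
  refine ⟨∑ e ∈ L.divisors, S e, fun n ↦ ?_⟩
  have hq : qExpansion 1 ⇑(∑ e ∈ L.divisors, S e) = ∑ e ∈ L.divisors, qExpansion 1 ⇑(S e) :=
    map_sum (ModularForm.qExpansionAddHom one_pos hΓ k) S _
  rw [hq, map_sum (PowerSeries.coeff n)]
  exact Finset.sum_congr rfl fun e he ↦ hqS e he n

/-- **Finite `V`-towers over a classical form are classical** (stub `stub_finiteTowerClassical`
of crux stmt-Langlands-8927, line Sketch): verbatim the registered signature, by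
`finiteTowerClassical`. [cite: DiamondShurman2005, §5.7 p. 211] -/
theorem stub_finiteTowerClassical (M : ℕ) [NeZero M] (k : ℤ)
    (h : ModularForm (CongruenceSubgroup.Gamma1 M) k) (L : ℕ) (hL : 0 < L) (μ : ℕ → ℂ) :
    ∃ G : ModularForm (CongruenceSubgroup.Gamma1 (M * L)) k, ∀ n : ℕ,
      PowerSeries.coeff n (UpperHalfPlane.qExpansion 1 ⇑G) =
        ∑ e ∈ L.divisors,
          if e ∣ n then μ e * PowerSeries.coeff (n / e) (UpperHalfPlane.qExpansion 1 ⇑h) else 0 :=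
  finiteTowerClassical M k h L hL μ

end Summit.Langlands.Langlands.Theorems.CapacityClassicality

end
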